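import Summits.QuantumFields.YangMills.Theorems.LangevinControlUVFemtoCurvatureTwoPointCReduction
import Summits.QuantumFields.YangMills.Theorems.LangevinControlUVFemtoCurvatureTwoPointCDefsSplit
import Summits.QuantumFields.YangMills.Theorems.LangevinControlUVFemtoCurvatureTwoPointCStubPairsOfProfiles
import Summits.QuantumFields.YangMills.Theorems.LangevinControlUVFemtoCurvatureTwoPointPlaquetteCovCeiling

/-!
# Route `LangevinControlUV`, crux `FemtoCurvatureTwoPointC` (stmt-QuantumFields-16204), line `Sketch` — reshape v5 bridge:
# femto boxes + small tori ⇒ `AFCouplingAt r` ⇒ the crux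

Continuation lead `prover-line-stmt-QuantumFields-16204-c3-0`, cycle 5 (vocabulary `…CDefsSplit`). For EVERY compact `G` (any
Borel structure) and every lattice representation `r`:

  `AFProfilesBigAt r → SmallTorusVarianceLawAt r → AFCouplingAt r`   (`afCouplingAt_of_big_of_small`),

hence `AFProfilesBig → SmallTorusVarianceLaw → FemtoCurvatureTwoPointC` (`femtoCurvatureTwoPointC_of_big_of_small`, registered
sub-goal) through the cycle-1 reduction `femtoCurvatureTwoPointC_of_afCoupling` (p123348). Ingredients, all landed:

* boxes `L ≥ 8`: the per-torus form `pairBound_of_profilesAt` of the reflection-positivity bridge (same proof as the registered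
  `stub_pairsOfProfiles`, p127516, whose hypotheses are global in `L`; here they are needed on ONE torus): off-axis domination
  + two profiles + fold + window ratio, via the exported per-term bound `diagTerm_le`;
* tori `2 ≤ L ≤ 7`: the Cauchy–Schwarz ceiling `FemtoCurvatureTwoPoint.abs_plaquetteCov_le_plaquetteVar_rep` (`|Cov| ≤ Var(P^{01})`),
  the small-torus variance law `Var ≤ K/β²`, the bare-size clause `c₈ ≤ β·u(8,β)` (so `K/β² ≤ (K/c₈²)·u(8,β)²`), `dist ≤ L ≤ 7`
  (`torusDist_le`), and `max 8 (min L ·) = 8`;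
* the torus `L = 1` has no pair `x ≠ y`.

Constants of the resulting `AFCouplingAt`: window height `min u₀ (1/(4(|κ₂|+1)))`, threshold `max (max β₀ β_small) 1`,
pair constant `3·2¹⁸·max C 0 + 7⁸·max K 0/c₈²`. Nothing is asserted; no `sorry`.
-/

set_option autoImplicit false

noncomputable section

open Filter Topology MeasureTheory
open Literature.MathematicalPhysics.QuantumFieldTheory

namespace Summit.QuantumFields.YangMills.Theorems.FemtoCurvatureTwoPointC

section PerTorus

variable {G : Type} [Group G] [TopologicalSpace G] [IsTopologicalGroup G] [CompactSpace G]
  [MeasurableSpace G] [BorelSpace G] {N : ℕ} (ρ : G →* Matrix (Fin N) (Fin N) ℂ)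

/-- **Pairs from profiles on ONE torus.** The per-torus form of `stub_pairsOfProfiles`: on a window torus `L` at `β ≥ 0`,
the transverse/longitudinal profile bounds (`1 ≤ s ≤ L/2`) and the variance ceiling ON THIS TORUS give
`|Cov(P_x^{ij},P_y^{i'j'})|·dist⁸ ≤ 3·2¹⁸·C·u(max 8 (min L (8⌈dist⌉)))²`. Same proof (off-axis domination p108776, `diagTerm_le`).
[folklore] -/
theorem pairBound_of_profilesAt (hρ : Continuous ρ) (u : ℕ → ℝ → ℝ) (u₀ w κ₂ C : ℝ) (hC : 0 ≤ C)
    (hw₀ : w ≤ u₀) (hwκ : w * (|κ₂| + 1) ≤ 1 / 4) {L : ℕ} [NeZero L] {β : ℝ} (hβ : 0 ≤ β)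
    (hpos : ∀ M : ℕ, 8 ≤ M → 0 < u M β)
    (hcomp : ∀ (M M' : ℕ), 8 ≤ M → M ≤ M' → M' ≤ 2 * M →
      (∀ M'' : ℕ, 8 ≤ M'' → M'' ≤ M → u M'' β ≤ u₀) → |(u M β)⁻¹ - (u M' β)⁻¹| ≤ κ₂)
    (hwin : ∀ M : ℕ, 8 ≤ M → M ≤ L → u M β ≤ w)
    (P : (Fin 4 → ZMod L) → Fin 4 → Fin 4 → GaugeConfig 4 L G → ℝ) (E : (GaugeConfig 4 L G → ℝ) → ℝ)
    (hP : P = fun x i j U => (N : ℝ) - (ρ (plaquetteHolonomy U x i j)).trace.re)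
    (hE : E = fun F => wilsonExpectation ρ β F)
    (hTU : ∀ s : ℕ, 1 ≤ s → 2 * s ≤ L →
      (s : ℝ) ^ 8 * (E (fun U => P 0 0 1 U * P (Pi.single (2 : Fin 4) ((s : ℕ) : ZMod L)) 0 1 U)
        - E (P 0 0 1) * E (P (Pi.single (2 : Fin 4) ((s : ℕ) : ZMod L)) 0 1)) ≤
        C * u (max 8 (min L (8 * s))) β ^ 2)
    (hLU : ∀ s : ℕ, 1 ≤ s → 2 * s ≤ L →
      (s : ℝ) ^ 8 * |E (fun U => P 0 0 1 U * P (Pi.single (0 : Fin 4) ((s : ℕ) : ZMod L)) 0 1 U)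
        - E (P 0 0 1) * E (P (Pi.single (0 : Fin 4) ((s : ℕ) : ZMod L)) 0 1)| ≤
        C * u (max 8 (min L (8 * s))) β ^ 2)
    (hV : E (fun U => P 0 0 1 U * P 0 0 1 U) - E (P 0 0 1) * E (P 0 0 1) ≤ C * u 8 β ^ 2)
    (x y : Fin 4 → ZMod L) (i j i' j' : Fin 4) (hxy : x ≠ y) (hij : i ≠ j) (hij' : i' ≠ j') :
    |E (fun U => P x i j U * P y i' j' U) - E (P x i j) * E (P y i' j')| *
        Real.sqrt (∑ k : Fin 4, (((x k - y k).valMinAbs : ℤ) : ℝ) ^ 2) ^ 8 ≤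
      3 * 2 ^ 18 * C *
        u (max 8 (min L (8 * ⌈Real.sqrt (∑ k : Fin 4, (((x k - y k).valMinAbs : ℤ) : ℝ) ^ 2)⌉₊))) β ^ 2 := by
  -- geometry
  obtain ⟨μ, m, hm_def, hm1, hmL, -, -, hd2m, hmc, hc2m⟩ := stub_torusGeometry L x y hxy
  set D : ℝ := Real.sqrt (∑ k : Fin 4, (((x k - y k).valMinAbs : ℤ) : ℝ) ^ 2) with hD
  set b : ℕ := ⌈D⌉₊ with hb
  set Mstar : ℕ := max 8 (min L (8 * b)) with hMstar
  have hmpos : (0 : ℝ) < m := by exact_mod_cast hm1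
  have hm8pos : (0 : ℝ) < (m : ℝ) ^ 8 := by positivity
  -- off-axis domination along `μ`
  have hOA := FemtoCurvatureTwoPoint.stub_offAxisDomination G N ρ hρ L β hβ P E hP hE μ x y i j i' j'
    hij hij' (by rw [← hm_def]; exact hm1)
  rw [← hm_def] at hOA
  -- the per-term bound with `B = 2¹⁰ C u(Mstar)² / m⁸`
  set B : ℝ := 2 ^ 10 * C * u Mstar β ^ 2 / (m : ℝ) ^ 8 with hB
  have hterm : ∀ (a a' : Fin 4), a ≠ a' → ∀ t : ℕ, t < 3 →
      |E (fun U => P 0 a a' U * P (Pi.single μ (((m - 1 + t : ℕ) : ℕ) : ZMod L)) a a' U)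
        - E (P 0 a a') * E (P (Pi.single μ (((m - 1 + t : ℕ) : ℕ) : ZMod L)) a a')| ≤ B :=
    fun a a' haa' t ht =>
      diagTerm_le ρ hρ u u₀ w κ₂ C hC hw₀ hwκ hβ hpos hcomp hwin P E hP hE hTU hLU hV hm1 hmL hmc hc2m
        a a' μ haa' t ht
  have hS1 : ∑ t ∈ Finset.range 3,
      |E (fun U => P 0 i j U * P (Pi.single μ (((m - 1 + t : ℕ) : ℕ) : ZMod L)) i j U)
        - E (P 0 i j) * E (P (Pi.single μ (((m - 1 + t : ℕ) : ℕ) : ZMod L)) i j)| ≤ 3 * B :=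
    sum_range_three_le (hterm i j hij)
  have hS2 : ∑ t ∈ Finset.range 3,
      |E (fun U => P 0 i' j' U * P (Pi.single μ (((m - 1 + t : ℕ) : ℕ) : ZMod L)) i' j' U)
        - E (P 0 i' j') * E (P (Pi.single μ (((m - 1 + t : ℕ) : ℕ) : ZMod L)) i' j')| ≤ 3 * B :=
    sum_range_three_le (hterm i' j' hij')
  have hS2nn : 0 ≤ ∑ t ∈ Finset.range 3,
      |E (fun U => P 0 i' j' U * P (Pi.single μ (((m - 1 + t : ℕ) : ℕ) : ZMod L)) i' j' U)
        - E (P 0 i' j') * E (P (Pi.single μ (((m - 1 + t : ℕ) : ℕ) : ZMod L)) i' j')| :=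
    Finset.sum_nonneg fun t _ => abs_nonneg _
  have hB0 : 0 ≤ B := by
    rw [hB]; exact div_nonneg (mul_nonneg (mul_nonneg (by norm_num) hC) (sq_nonneg _)) hm8pos.le
  have hsq : (E (fun U => P x i j U * P y i' j' U) - E (P x i j) * E (P y i' j')) ^ 2 ≤ (3 * B) ^ 2 := by
    refine hOA.trans ?_
    rw [sq]
    exact mul_le_mul hS1 hS2 hS2nn (by positivity)
  have habs : |E (fun U => P x i j U * P y i' j' U) - E (P x i j) * E (P y i' j')| ≤ 3 * B :=
    abs_le_of_sq_le_sq_real hsq (by positivity)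
  -- `dist⁸ ≤ 2⁸ m⁸`
  have hD0 : 0 ≤ D := Real.sqrt_nonneg _
  have hD8 : D ^ 8 ≤ 2 ^ 8 * (m : ℝ) ^ 8 := by
    have h := pow_le_pow_left₀ hD0 hd2m 8
    rw [mul_pow] at h
    exact h
  calc |E (fun U => P x i j U * P y i' j' U) - E (P x i j) * E (P y i' j')| * D ^ 8
      ≤ 3 * B * (2 ^ 8 * (m : ℝ) ^ 8) :=
        mul_le_mul habs hD8 (by positivity) (by positivity)
    _ = 3 * 2 ^ 18 * C * u Mstar β ^ 2 := by
        rw [hB]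
        field_simp

/-- The Cauchy–Schwarz ceiling `|Cov_{L,β}(P_x^{ij}, P_y^{i'j'})| ≤ Var_{L,β}(P_0^{01})` for a lattice representation `r`, in the
crux's abstract `P`/`E` vocabulary (wrapper of the landed `FemtoCurvatureTwoPoint.abs_plaquetteCov_le_plaquetteVar_rep`).
[folklore] -/
theorem abs_cov_le_var_PE (r : LatticeRep G) {L : ℕ} [NeZero L] (β : ℝ)
    (P : (Fin 4 → ZMod L) → Fin 4 → Fin 4 → GaugeConfig 4 L G → ℝ) (E : (GaugeConfig 4 L G → ℝ) → ℝ)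
    (hP : P = fun x i j U => (r.N : ℝ) - (r.ρ (plaquetteHolonomy U x i j)).trace.re)
    (hE : E = fun F => wilsonExpectation r.ρ β F) (x y : Fin 4 → ZMod L) (i j i' j' : Fin 4) :
    |E (fun U => P x i j U * P y i' j' U) - E (P x i j) * E (P y i' j')| ≤
      E (fun U => P 0 0 1 U * P 0 0 1 U) - E (P 0 0 1) * E (P 0 0 1) := by
  subst hP hE
  have h := FemtoCurvatureTwoPoint.abs_plaquetteCov_le_plaquetteVar_rep G r L β x y i j i' j'
  simp only [sq] at h
  exact h

end PerTorus

/-! ## The v5 bridge -/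

/-- **Femto boxes + small tori give pairs (per datum).** `AFProfilesBigAt r → SmallTorusVarianceLawAt r → AFCouplingAt r` for
every compact group `G` and lattice representation `r`: window height `min u₀ (1/(4(|κ₂|+1)))`, threshold
`max (max β₀ β_small) 1`, pair constant `3·2¹⁸·max C 0 + 7⁸·max K 0/c₈²`; axis clause = transverse lower + transverse upper at
`s = n`; pair clause = `pairBound_of_profilesAt` on boxes `L ≥ 8`, Cauchy–Schwarz + variance law + bare size on `2 ≤ L ≤ 7`. -/
theorem afCouplingAt_of_big_of_small {G : Type} [Group G] [TopologicalSpace G] [IsTopologicalGroup G] [CompactSpace G]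
    [MeasurableSpace G] [BorelSpace G] (r : LatticeRep G) (hbig : AFProfilesBigAt r)
    (hsmall : SmallTorusVarianceLawAt r) : AFCouplingAt r := by
  obtain ⟨u, u₀, β₀, κ₁, κ₂, κ₃, c, C, c₈, hu₀, hc, hκ₁, hκ₃, hc₈, hpos, hcont, hfrz, hbare, hcomp, hstep,
    hTL, hTU, hLU, hV⟩ := hbig
  obtain ⟨K, β₂, hvar⟩ := hsmall
  -- the shrunk window height and the raised threshold
  set w : ℝ := min u₀ (1 / (4 * (|κ₂| + 1))) with hw_def
  have hKpos : 0 < |κ₂| + 1 := by positivity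
  have hw₀ : w ≤ u₀ := min_le_left _ _
  have hwpos : 0 < w := lt_min hu₀ (by positivity)
  have hwκ : w * (|κ₂| + 1) ≤ 1 / 4 := by
    have h1 : w ≤ 1 / (4 * (|κ₂| + 1)) := min_le_right _ _
    calc w * (|κ₂| + 1) ≤ 1 / (4 * (|κ₂| + 1)) * (|κ₂| + 1) :=
          mul_le_mul_of_nonneg_right h1 hKpos.le
      _ = 1 / 4 := by field_simp
  set β₁ : ℝ := max (max β₀ β₂) 1 with hβ₁_def
  have hβ₁₀ : β₀ ≤ β₁ := (le_max_left _ _).trans (le_max_left _ _)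
  have hβ₁₂ : β₂ ≤ β₁ := (le_max_right _ _).trans (le_max_left _ _)
  have hβ₁1 : 1 ≤ β₁ := le_max_right _ _
  set Cp : ℝ := max C 0 with hCp
  set Kp : ℝ := max K 0 with hKp
  have hC0 : 0 ≤ Cp := le_max_right _ _
  have hK0 : 0 ≤ Kp := le_max_right _ _
  set C' : ℝ := 3 * 2 ^ 18 * Cp + 7 ^ 8 * Kp / c₈ ^ 2 with hC'_def
  have hsmallC : 0 ≤ 7 ^ 8 * Kp / c₈ ^ 2 := by positivity
  have hbigC : 0 ≤ 3 * 2 ^ 18 * Cp := by positivity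
  have hCC' : C ≤ C' := by
    have h1 : C ≤ Cp := le_max_left _ _
    have h2 : Cp ≤ 3 * 2 ^ 18 * Cp := by nlinarith
    rw [hC'_def]; linarith
  -- windows w.r.t. `w` are windows w.r.t. `u₀`
  have hwin_mono : ∀ (L : ℕ) (β : ℝ), (∀ M : ℕ, 8 ≤ M → M ≤ L → u M β ≤ w) →
      ∀ M : ℕ, 8 ≤ M → M ≤ L → u M β ≤ u₀ := fun L β h M h8 hM => (h M h8 hM).trans hw₀
  refine ⟨u, w, β₁, κ₁, κ₂, κ₃, c, C', hwpos, hc, hκ₁, hκ₃,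
    fun L β hL hβ => hpos L β hL (hβ₁₀.trans hβ),
    fun L hL => (hcont L hL).mono (Set.Ici_subset_Ici.2 hβ₁₀),
    fun L hL => hfrz L hL,
    fun L L' β hβ hL hLL' hL'L hwin => hcomp L L' β (hβ₁₀.trans hβ) hL hLL' hL'L (hwin_mono L β hwin),
    fun k m β hβ hwin => hstep k m β (hβ₁₀.trans hβ) (hwin_mono _ β hwin), ?_, ?_⟩
  · -- two-sided axis clause: transverse lower + transverse upper at `s = n` (`L ≥ 8n ≥ 8`)
    intro L _ β n hβ hn hnL hwin P E hP hE
    refine ⟨hTL L β n (hβ₁₀.trans hβ) hn hnL (hwin_mono L β hwin) P E hP hE, ?_⟩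
    have h2n : 2 * n ≤ L := by omega
    have hsc : max 8 (min L (8 * n)) = 8 * n := by
      rw [Nat.min_eq_right hnL, Nat.max_eq_right (by omega)]
    have h := hTU L β n (hβ₁₀.trans hβ) (by omega) hn h2n (hwin_mono L β hwin) P E hP hE
    rw [hsc] at h
    exact h.trans (mul_le_mul_of_nonneg_right hCC' (sq_nonneg _))
  · -- all pairs
    intro L _ β hβ hwin P E hP hE x y i j i' j' hxy hij hij'
    have hβ0 : β₀ ≤ β := hβ₁₀.trans hβ
    have hβpos : 0 < β := lt_of_lt_of_le one_pos (hβ₁1.trans hβ)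
    set D : ℝ := Real.sqrt (∑ k : Fin 4, (((x k - y k).valMinAbs : ℤ) : ℝ) ^ 2) with hD
    rcases le_or_gt 8 L with hL8 | hL8
    · -- femto box `L ≥ 8`: the reflection-positivity bridge on this torus, constant `Cp`
      have hwin₀ := hwin_mono L β hwin
      have h := pairBound_of_profilesAt r.ρ r.continuous u u₀ w κ₂ Cp hC0 hw₀ hwκ hβpos.le
        (fun M h8 => hpos M β h8 hβ0)
        (fun M M' h8 hMM' hM'M hwM => hcomp M M' β hβ0 h8 hMM' hM'M hwM) hwin P E hP hE
        (fun s hs hsL => (hTU L β s hβ0 hL8 hs hsL hwin₀ P E hP hE).trans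
          (mul_le_mul_of_nonneg_right (le_max_left _ _) (sq_nonneg _)))
        (fun s hs hsL => (hLU L β s hβ0 hL8 hs hsL hwin₀ P E hP hE).trans
          (mul_le_mul_of_nonneg_right (le_max_left _ _) (sq_nonneg _)))
        ((hV L β hβ0 hL8 hwin₀ P E hP hE).trans (mul_le_mul_of_nonneg_right (le_max_left _ _) (sq_nonneg _)))
        x y i j i' j' hxy hij hij'
      refine h.trans ?_
      have hu2 : 0 ≤ u (max 8 (min L (8 * ⌈D⌉₊))) β ^ 2 := sq_nonneg _
      have : 3 * 2 ^ 18 * Cp ≤ C' := by rw [hC'_def]; linarith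
      exact mul_le_mul_of_nonneg_right this hu2
    · -- small torus `L ≤ 7`: Cauchy–Schwarz, the variance law, the bare size
      have hL2 : 2 ≤ L := by
        by_contra hlt
        have hL1 : L = 1 := by have := NeZero.ne L; omega
        subst hL1
        exact hxy (Subsingleton.elim x y)
      have hsc : max 8 (min L (8 * ⌈D⌉₊)) = 8 := by
        apply Nat.max_eq_left
        exact (Nat.min_le_left _ _).trans (by omega)
      rw [hsc]
      -- `|Cov| ≤ Var ≤ K/β² ≤ Kp/β²`
      have hcv := abs_cov_le_var_PE r β P E hP hE x y i j i' j'
      have hvr := hvar L β hL2 hL8 (hβ₁₂.trans hβ) P E hP hE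
      have hKK : K / β ^ 2 ≤ Kp / β ^ 2 := div_le_div_of_nonneg_right (le_max_left _ _) (by positivity)
      -- bare size: `Kp/β² ≤ (Kp/c₈²)·u(8,β)²`
      have hb := hbare β hβ0
      have hu8 : 0 < u 8 β := hpos 8 β le_rfl hβ0
      have hβu : c₈ ^ 2 ≤ (β * u 8 β) ^ 2 := pow_le_pow_left₀ hc₈.le hb 2
      have hunit : Kp / β ^ 2 ≤ Kp / c₈ ^ 2 * u 8 β ^ 2 := by
        rw [div_le_iff₀ (by positivity)]
        have : Kp / c₈ ^ 2 * u 8 β ^ 2 * β ^ 2 = Kp / c₈ ^ 2 * (β * u 8 β) ^ 2 := by ring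
        rw [this]
        have h1 : Kp = Kp / c₈ ^ 2 * c₈ ^ 2 := by field_simp
        calc Kp = Kp / c₈ ^ 2 * c₈ ^ 2 := h1
          _ ≤ Kp / c₈ ^ 2 * (β * u 8 β) ^ 2 := mul_le_mul_of_nonneg_left hβu (by positivity)
      have hcov : |E (fun U => P x i j U * P y i' j' U) - E (P x i j) * E (P y i' j')| ≤
          Kp / c₈ ^ 2 * u 8 β ^ 2 := hcv.trans (hvr.trans (hKK.trans hunit))
      -- `dist ≤ L ≤ 7`
      have hD0 : 0 ≤ D := Real.sqrt_nonneg _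
      have hDL : D ≤ 7 := by
        have h1 : D ≤ L := torusDist_le x y
        have h2 : (L : ℝ) ≤ 7 := by exact_mod_cast (by omega : L ≤ 7)
        exact h1.trans h2
      have hD8 : D ^ 8 ≤ 7 ^ 8 := pow_le_pow_left₀ hD0 hDL 8
      have hu2 : 0 ≤ u 8 β ^ 2 := sq_nonneg _
      calc |E (fun U => P x i j U * P y i' j' U) - E (P x i j) * E (P y i' j')| * D ^ 8
          ≤ Kp / c₈ ^ 2 * u 8 β ^ 2 * 7 ^ 8 :=
            mul_le_mul hcov hD8 (by positivity) (by positivity)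
        _ = 7 ^ 8 * Kp / c₈ ^ 2 * u 8 β ^ 2 := by ring
        _ ≤ C' * u 8 β ^ 2 := by
            refine mul_le_mul_of_nonneg_right ?_ hu2
            rw [hC'_def]; linarith

/-- **Femto boxes + small tori give pairs (universal closure).** `AFProfilesBig → SmallTorusVarianceLaw → AFCoupling`. -/
theorem afCoupling_of_big_of_small (hbig : AFProfilesBig) (hsmall : SmallTorusVarianceLaw) : AFCoupling :=
  fun G _ _ _ _ _ _ hG r => afCouplingAt_of_big_of_small r (hbig G hG r) (hsmall G hG r)

/-- **Reduction at fixed data, v5.** `AFProfilesBigAt r → SmallTorusVarianceLawAt r → CruxCAt r` for every compact group `G`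
and lattice representation `r`. -/
theorem cruxCAt_of_big_of_small {G : Type} [Group G] [TopologicalSpace G] [IsTopologicalGroup G] [CompactSpace G]
    [MeasurableSpace G] [BorelSpace G] (r : LatticeRep G) (hbig : AFProfilesBigAt r)
    (hsmall : SmallTorusVarianceLawAt r) : CruxCAt r :=
  cruxCAt_of_afCouplingAt r (afCouplingAt_of_big_of_small r hbig hsmall)

/-- **Registered sub-goal `femtoCurvatureTwoPointC_of_big_of_small` (crux stmt-QuantumFields-16204, line `Sketch`, v5): the
crux follows from the femto-box physics statement and the small-torus variance law.**
`AFProfilesBig → SmallTorusVarianceLaw → FemtoCurvatureTwoPointC` — the closing theorem for the crux once the two registered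
stubs `stub_afProfilesBig`, `stub_smallTorusVariance` are proved. -/
theorem femtoCurvatureTwoPointC_of_big_of_small :
    AFProfilesBig → SmallTorusVarianceLaw →
      Summit.QuantumFields.YangMills.Theses.LangevinControlUV.FemtoCurvatureTwoPointC :=
  fun hbig hsmall => femtoCurvatureTwoPointC_of_afCoupling (afCoupling_of_big_of_small hbig hsmall)

end Summit.QuantumFields.YangMills.Theorems.FemtoCurvatureTwoPointC

end
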